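import Mathlib

/-!
# Entropy balance (K4), helper 1: the coboundary lemma

Helper file for crux `stmt-AtomisticToContinuum-9122` (`BondHeatUncertainty.LinearResponseFTUR`), line
`lebesgue-flip-duality`, stub `stub_entropyBalance` (the stationary entropy balance). In the
Lebowitz–Spohn formula `log(dP/dΘ̃_*P) = llr(μ, Θ_*μ)(x_0) + [f(x_0) - f(x_t)] - W` the middle term is a
COBOUNDARY `D = f(x_0) - f(x_t)` of a merely measurable `f = log ρ∘Θ` along two coordinates with the SAME
law (stationarity). This file proves the abstract fact that makes the finite-entropy hypothesis
`log ρ ∈ L¹` unnecessary: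

* `coboundary_integral_eq_zero` — on a finite measure space, if `x_0, x_t : Ω → X` have the same law,
  `f : X → ℝ` is measurable and `D = f∘x_0 - f∘x_t` is bounded below by `-g` with `g` integrable, then
  `D` is integrable and `∫ D = 0`.

Proof: truncate `f_n = (f ∧ n) ∨ (-n)`; `D_n = f_n∘x_0 - f_n∘x_t` is bounded with `∫ D_n = 0` (equal
laws); clamping is monotone and `1`-Lipschitz, so `D_n⁻ ≤ D⁻ ≤ |g|`, `|D_n| ≤ |D|`, `D_n → D`; hence
`∫ D_n⁺ = ∫ D_n⁻ ≤ ∫ D⁻`, Fatou bounds `∫ D⁺`, and dominated convergence gives `∫ D = lim ∫ D_n = 0`.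
-/

noncomputable section

namespace Summit.AtomisticToContinuum.FouriersLaw.Theorems.LinearResponseFTUR

open MeasureTheory Filter Topology

/-- Clamping to `[-n, n]` is monotone and `1`-Lipschitz: for `v ≤ u`,
`0 ≤ clamp u - clamp v ≤ u - v`. [folklore] -/
theorem clamp_sub_clamp_mem {u v n : ℝ} (h : v ≤ u) :
    0 ≤ max (min u n) (-n) - max (min v n) (-n) ∧ max (min u n) (-n) - max (min v n) (-n) ≤ u - v := by
  constructor
  · have : max (min v n) (-n) ≤ max (min u n) (-n) := max_le_max (min_le_min h le_rfl) le_rfl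
    linarith
  · simp only [max_def, min_def]
    split_ifs <;> linarith

/-- Clamping to `[-n, n]` fixes `[-n, n]`. [folklore] -/
theorem clamp_eq_self {u n : ℝ} (h : |u| ≤ n) : max (min u n) (-n) = u := by
  rw [abs_le] at h
  rw [min_eq_left h.2, max_eq_left h.1]

/-- Clamping to `[-n, n]` (`n ≥ 0`) lands in `[-n, n]`. [folklore] -/
theorem abs_clamp_le {u n : ℝ} (hn : 0 ≤ n) : |max (min u n) (-n)| ≤ n := by
  rw [abs_le]
  exact ⟨le_max_right _ _, max_le (min_le_right _ _) (by linarith)⟩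

/-- The truncated coboundary has the sign of the coboundary and is dominated by it:
with `c = clamp_n`, `|c u - c v| ≤ |u - v|`, `(c u - c v)⁻ ≤ (u - v)⁻`. [folklore] -/
theorem clamp_sub_clamp_dominated (u v n : ℝ) :
    |max (min u n) (-n) - max (min v n) (-n)| ≤ |u - v| ∧
    max (-(max (min u n) (-n) - max (min v n) (-n))) 0 ≤ max (-(u - v)) 0 := by
  rcases le_total v u with h | h
  · obtain ⟨h1, h2⟩ := clamp_sub_clamp_mem (n := n) h
    refine ⟨?_, ?_⟩
    · rw [abs_of_nonneg h1, abs_of_nonneg (sub_nonneg.2 h)]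
      exact h2
    · have e : max (-(max (min u n) (-n) - max (min v n) (-n))) 0 = 0 :=
        max_eq_right (by linarith)
      rw [e]
      exact le_max_right _ _
  · obtain ⟨h1, h2⟩ := clamp_sub_clamp_mem (n := n) h
    refine ⟨?_, ?_⟩
    · rw [abs_sub_comm, abs_of_nonneg h1, abs_sub_comm u v, abs_of_nonneg (sub_nonneg.2 h)]
      exact h2
    · have e : -(max (min u n) (-n) - max (min v n) (-n)) ≤ -(u - v) := by linarith
      exact max_le (e.trans (le_max_left _ _)) (le_max_right _ _)

/-- **The coboundary lemma.** On a finite measure space, let `x0, xt : Ω → X` be measurable with the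
same law, `f : X → ℝ` measurable, and suppose the coboundary `D = f∘x0 - f∘xt` is bounded below,
almost everywhere, by `-g` for an integrable `g`. Then `D` is integrable and `∫ D = 0` — although `f`
itself need not be integrable. (Truncation `f_n = (f ∧ n) ∨ (-n)`: `∫ (f_n∘x0 - f_n∘xt) = 0`, the
truncated coboundaries have the sign of `D` and are dominated by `|D|`, so Fatou bounds `∫ D⁺` by
`∫ D⁻ ≤ ∫ |g|` and dominated convergence identifies `∫ D = 0`.) Registered sub-goal of crux
stmt-AtomisticToContinuum-9122 (stub `stub_entropyBalance`). [folklore] -/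
theorem coboundary_integral_eq_zero :
    ∀ {Ω X : Type*} [MeasurableSpace Ω] [MeasurableSpace X] (P : Measure Ω) [IsFiniteMeasure P]
      (x0 xt : Ω → X) (f : X → ℝ) (g : Ω → ℝ), Measurable x0 → Measurable xt → Measurable f →
      P.map x0 = P.map xt → Integrable g P → (∀ᵐ ω ∂P, -g ω ≤ f (x0 ω) - f (xt ω)) →
      Integrable (fun ω => f (x0 ω) - f (xt ω)) P ∧ ∫ ω, (f (x0 ω) - f (xt ω)) ∂P = 0 := by
  intro Ω X _ _ P _ x0 xt f g hx0 hxt hf hlaw hg hlow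
  -- the coboundary and its truncations
  set D : Ω → ℝ := fun ω => f (x0 ω) - f (xt ω) with hD
  have hDm : Measurable D := (hf.comp hx0).sub (hf.comp hxt)
  set c : ℕ → ℝ → ℝ := fun n u => max (min u n) (-n) with hc
  have hcm : ∀ n, Measurable (c n) := fun n => (measurable_id.min measurable_const).max measurable_const
  set G : ℕ → Ω → ℝ := fun n ω => c n (f (x0 ω)) - c n (f (xt ω)) with hG
  have hGm : ∀ n, Measurable (G n) := fun n =>
    ((hcm n).comp (hf.comp hx0)).sub ((hcm n).comp (hf.comp hxt))
  have hci : ∀ (n : ℕ) {y : Ω → X}, Measurable y → Integrable (fun ω => c n (f (y ω))) P := by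
    intro n y hy
    refine Integrable.of_bound (C := (n : ℝ)) (((hcm n).comp (hf.comp hy)).aestronglyMeasurable) ?_
    exact Eventually.of_forall fun ω => by
      rw [Real.norm_eq_abs]
      exact abs_clamp_le (Nat.cast_nonneg n)
  have hGi : ∀ n, Integrable (G n) P := fun n => (hci n hx0).sub (hci n hxt)
  -- zero mean of the truncated coboundaries (equal laws)
  have hG0 : ∀ n, ∫ ω, G n ω ∂P = 0 := by
    intro n
    have hsm : AEStronglyMeasurable (fun x => c n (f x)) (P.map xt) :=
      ((hcm n).comp hf).aestronglyMeasurable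
    have e1 : ∫ ω, c n (f (x0 ω)) ∂P = ∫ x, c n (f x) ∂(P.map x0) :=
      (integral_map hx0.aemeasurable (hlaw ▸ hsm)).symm
    have e2 : ∫ ω, c n (f (xt ω)) ∂P = ∫ x, c n (f x) ∂(P.map xt) :=
      (integral_map hxt.aemeasurable hsm).symm
    change ∫ ω, (c n (f (x0 ω)) - c n (f (xt ω))) ∂P = 0
    rw [integral_sub (hci n hx0) (hci n hxt), e1, e2, hlaw, sub_self]
  -- pointwise domination and convergence
  have hdom : ∀ n ω, |G n ω| ≤ |D ω| ∧ max (-(G n ω)) 0 ≤ max (-(D ω)) 0 := fun n ω =>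
    clamp_sub_clamp_dominated (f (x0 ω)) (f (xt ω)) n
  have hlim : ∀ ω, ∀ᶠ n in atTop, G n ω = D ω := by
    intro ω
    refine eventually_atTop.2 ⟨⌈max |f (x0 ω)| |f (xt ω)|⌉₊, fun n hn => ?_⟩
    have hn' : max |f (x0 ω)| |f (xt ω)| ≤ n := (Nat.le_ceil _).trans (by exact_mod_cast hn)
    change c n (f (x0 ω)) - c n (f (xt ω)) = f (x0 ω) - f (xt ω)
    simp only [hc]
    rw [clamp_eq_self ((le_max_left _ _).trans hn'), clamp_eq_self ((le_max_right _ _).trans hn')]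
  -- the negative part of `D` is integrable
  have hDneg : Integrable (fun ω => max (-(D ω)) 0) P := by
    refine hg.abs.mono' (hDm.neg.max measurable_const).aestronglyMeasurable ?_
    filter_upwards [hlow] with ω hω
    rw [Real.norm_eq_abs, abs_of_nonneg (le_max_right _ _)]
    have hDω : D ω = f (x0 ω) - f (xt ω) := rfl
    have h1 : -(D ω) ≤ |g ω| := by linarith [le_abs_self (g ω)]
    exact max_le h1 (abs_nonneg _)
  -- `∫ G_n⁺ = ∫ G_n⁻ ≤ ∫ D⁻`
  have hGpos : ∀ n, ∫ ω, max (G n ω) 0 ∂P ≤ ∫ ω, max (-(D ω)) 0 ∂P := by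
    intro n
    have h1 : ∫ ω, max (G n ω) 0 ∂P - ∫ ω, max (-(G n ω)) 0 ∂P = 0 := by
      rw [← integral_sub (hGi n).pos_part (hGi n).neg_part]
      simp only [max_zero_sub_max_neg_zero_eq_self]
      exact hG0 n
    have h2 : ∫ ω, max (-(G n ω)) 0 ∂P ≤ ∫ ω, max (-(D ω)) 0 ∂P :=
      integral_mono (hGi n).neg_part hDneg fun ω => (hdom n ω).2
    linarith
  -- Fatou: the positive part of `D` is integrable
  have hDpos : Integrable (fun ω => max (D ω) 0) P := by
    refine ⟨(hDm.max measurable_const).aestronglyMeasurable, ?_⟩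
    refine (hasFiniteIntegral_iff_ofReal (f := fun ω => max (D ω) 0)
      (Eventually.of_forall fun ω => le_max_right _ _)).2 ?_
    have hle : ∫⁻ ω, ENNReal.ofReal (max (D ω) 0) ∂P ≤
        ENNReal.ofReal (∫ ω, max (-(D ω)) 0 ∂P) := by
      calc ∫⁻ ω, ENNReal.ofReal (max (D ω) 0) ∂P
          = ∫⁻ ω, liminf (fun n => ENNReal.ofReal (max (G n ω) 0)) atTop ∂P := by
            refine lintegral_congr fun ω => ?_
            refine (Tendsto.liminf_eq ?_).symm
            refine (tendsto_const_nhds (x := ENNReal.ofReal (max (D ω) 0))).congr' ?_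
            filter_upwards [hlim ω] with n hn
            rw [hn]
        _ ≤ liminf (fun n => ∫⁻ ω, ENNReal.ofReal (max (G n ω) 0) ∂P) atTop :=
            lintegral_liminf_le fun n => ((hGm n).max measurable_const).ennreal_ofReal
        _ ≤ ENNReal.ofReal (∫ ω, max (-(D ω)) 0 ∂P) := by
            refine liminf_le_of_frequently_le' (Frequently.of_forall fun n => ?_)
            rw [← ofReal_integral_eq_lintegral_ofReal (hGi n).pos_part
              (Eventually.of_forall fun ω => le_max_right _ _)]
            exact ENNReal.ofReal_le_ofReal (hGpos n)
    exact lt_of_le_of_lt hle ENNReal.ofReal_lt_top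
  have hDi : Integrable D P :=
    (hDpos.sub hDneg).congr (Eventually.of_forall fun ω => by
      simp only [Pi.sub_apply]
      exact max_zero_sub_max_neg_zero_eq_self (D ω))
  -- dominated convergence: `∫ D = lim ∫ G_n = 0`
  have htend : Tendsto (fun n => ∫ ω, G n ω ∂P) atTop (𝓝 (∫ ω, D ω ∂P)) := by
    refine tendsto_integral_of_dominated_convergence (fun ω => |D ω|)
      (fun n => (hGm n).aestronglyMeasurable) hDi.abs
      (fun n => Eventually.of_forall fun ω => ?_) (Eventually.of_forall fun ω => ?_)
    · rw [Real.norm_eq_abs]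
      exact (hdom n ω).1
    · exact (tendsto_const_nhds (x := D ω)).congr' (by
        filter_upwards [hlim ω] with n hn
        rw [hn])
  refine ⟨hDi, ?_⟩
  have h0 : Tendsto (fun n => ∫ ω, G n ω ∂P) atTop (𝓝 0) := by
    simp only [hG0]
    exact tendsto_const_nhds
  exact tendsto_nhds_unique htend h0

end Summit.AtomisticToContinuum.FouriersLaw.Theorems.LinearResponseFTUR

end
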